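import Literature.NumberTheory.Automorphic.UnramifiedIntegralConjugacy
import Literature.NumberTheory.Automorphic.GLnResiduallyRegularCentralizerCompactCore
import Literature.NumberTheory.Automorphic.CompactCoreCentralizerUnitary
import Literature.NumberTheory.Automorphic.ResiduallyRegularOrbitalIntegral
import Literature.NumberTheory.Automorphic.UnitaryGroupIntegralPointsReductionInert
import HarnessLib

/-!
# Residually regular elements of `U(J)(F_v)` at an unramified NON-SPLIT place: one `K_v`-class in `(G·γ) ∩ K_v`, and `Z(γ) ∩ K_v = compactCore Z(γ)`
(Kottwitz (1986), Prop. 7.1, Cor. 7.3; Rogawski (1990), §3.3 p. 21, §4.3 p. 43, §4.9 (b) p. 55; Tits (1979), §3.9)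

Topic `NumberTheory/Automorphic`; namespace `Literature.NumberTheory.Automorphic.UnitaryGroup`.  THEOREMS ONLY (no definition, no instance, no notation, no
named fact, no `sorry`).  Cell `pub/hodgecm-mathlib`, P3a, brick **«D-S3u-INERT-WRAP»** (LEAD F0P3a-plan (g8) T7-85 2026-09-01; A-p03 (g23)) = residue (r1) of
A-p01 (g20)'s «D-S3u ED. 3» census: the two binders of ★ `UnitaryResiduallyRegularOrbitalIntegral` (`classOrbitalIntegral_indicator_cmLocalIntegralLevel_eq_of_isCanonical`
:182 — `hK1` «one `K`-class», `hcore` «`G_γ ∩ K = compactCore G_γ`») DISCHARGED at an unramified non-split place `w ∣ v` (`c • w = w`) of good reduction for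
a residually regular `γ ∈ K_v = U(J)(𝒪_v)` (★ `localIntegralLevel`), i.e. one whose `GL_N(E_w)`-avatar `γ_w` (★ `localNonsplitEquiv`) has separable
characteristic polynomial and separable REDUCED characteristic polynomial (B-p14 (g29)'s idiom ★ `IntegralReduction.redMat`):

* §0 `charpoly_coe_localNonsplitEquiv` — `charpoly γ_w = (charpoly γ).map (eval at w)` (the `rfl` inlined twice in ★ `integralConj_of_nonsplit`, now citable);
  `charpoly_coe_eq_of_isConj` — conjugate elements of `U(J)(F_v)` have the same characteristic polynomial in `GL_N(E ⊗ F_v)`;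
  **`exists_integral_lift_separable_of_separable_redMat`** — THE BRIDGE between the two residual-separability idioms: B-p14 (g29)'s `(redMat g).charpoly.Separable`
  (★ `IntegralReduction.redMat`, `ValuativeRel` integers) ⇒ ★ F2-c's `∃ q : 𝒪_w[X], q.map subtype = charpoly g ∧ (q.map residue).Separable` over Mathlib's
  `w.adicCompletionIntegers E` (the two integer rings coincide, ★ `integer_valuation_eq_adicCompletionIntegers`; residue fields along `RingEquiv.subringCongr`).
* §1 (w1) **`forall_exists_mem_localIntegralLevel_conj_eq_of_isConj_of_nonsplit`** = `hK1`: every `U(J)(F_v)`-conjugate of `γ` inside `K_v` is a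
  `K_v`-conjugate — ★ `integralConj_unitaryGroupOfForm` (Kottwitz 7.1 in `U(σ_w, J_w)(E_w)`, hypothesis-free over ★ F2-c) transported along ★ `localNonsplitEquiv`
  by ★ `integralConj_of_mulEquiv` (A-p06 (g25)'s recipe); the residual hypothesis is ★ F2-c's `∃ q` integral separable lift of `charpoly γ_w`, VERBATIM;
  **`…_of_separable_redMat`** — the same in the ONE predicate of the night, `(redMat γ_w).charpoly.Separable` (via the §0 bridge).
* §2 (w2) **`setOf_mem_localIntegralLevel_eq_compactCore_centralizer_of_nonsplit`** = `hcore`: `{z ∈ Z(γ) ∣ ↑z ∈ K_v} = compactCore Z(γ)` — `⊆` ★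
  `preimage_val_subset_compactCore`; `⊇`: compact subgroups of `Z(γ)` push forward along the cod-restricted closed embedding `Z_{U}(γ) →* Z_{GL_N(E_w)}(γ_w)`
  (★ g0-U `isClosedEmbedding_subtype_comp_localNonsplitEquiv`, ★ `apply_mem_centralizer_of_mem_centralizer`) into `compactCore Z_{GL}(γ_w) = {· ∈ GL_N(𝒪_w)}`
  (★ B-p14 (c4) `GLn.setOf_mem_glInt_eq_compactCore_centralizer`), and `γ_w`-integrality is `K_v`-membership (★ `mem_localIntegralLevel_iff_of_smul_eq`).
CONSUMER: A-p01 (g20) «D-S3u ED. 3» §3∕§4 — at the CM carriers `(cmDatum L N H).Local v` ∕ `cmLocalIntegralLevel` these are the `«local»` ∕ `localIntegralLevel`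
types by `rfl` (★ `cmDatum_Local`), so (w1)(w2) are fed by `exact`.  PAYOFF: with ★ B-p14 (c3)(c4) at split places, the unit orbital integral `O_γ(1_{K_v}) = 1` at
residually regular `γ` holds at EVERY unramified place in-house — the regular-residual stratum of the non-split half of letter N7 (#103).
HONEST LABEL: dockings of ★ results (Kottwitz 7.1 is ★ `IntegralUnitaryConjugacyComplete`); HC_CM is proved only modulo the printed citations until rung 0 closes;
no count moves.

## Mathlib ∕ tree search
`tree-absence: rg -l localNonsplitEquiv … | xargs rg -l compactCore` → 6 hits (g0 ×2 mine, p08's canonical-family plumbing ×2, the a.e.-rational files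
`CompactCoreCentralizerLevelOfIntegralConjugacy` ∕ `UnramifiedOrbitSetAdelic`) — none states (w2) for a general `γ ∈ K_v`; `rg -l localIntegralLevel | xargs rg -l IsConj`
→ ★ `integralConj_of_nonsplit` is (w1) for RATIONAL `γ ⊗ 1` only (binder `hg : ↑g = toLocalGL E v γ`).  Tree used: ★ `UnramifiedIntegralConjugacy`
(`integralConj_unitaryGroupOfForm`, `integralConj_of_mulEquiv`), ★ `LocalUnitaryIntegralLevel` (`mem_localIntegralLevel_iff_of_smul_eq`, `isCompact_localIntegralLevel`),
★ `GLnResiduallyRegularCentralizerCompactCore` (`GLn.setOf_mem_glInt_eq_compactCore_centralizer`), ★ `CompactCoreCentralizerUnitary`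
(`isClosedEmbedding_subtype_comp_localNonsplitEquiv`, `apply_mem_centralizer_of_mem_centralizer`), ★ `ResiduallyRegularOrbitalIntegral`
(`preimage_val_subset_compactCore`), ★ `UnitaryGroupIntegralPointsReductionInert` (`integer_valuation_eq_adicCompletionIntegers`), ★ `OrbitalMeasureCanonical` (`mem_compactCore_iff`), ★ `LocalOrbitalMeasure` (`isClosed_coe_centralizer_singleton`).
Mathlib: `Matrix.charpoly_units_conj`, `Matrix.charpoly_map`, `isConj_iff`.

## References
* [Kottwitz1986] R. E. Kottwitz, *Stable trace formula: elliptic singular terms*, Math. Ann. 275 (1986), Prop. 7.1, Cor. 7.3.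
* [Rogawski1990] J. D. Rogawski, *Automorphic Representations of Unitary Groups in Three Variables* (1990), §3.3 p. 21, §4.3 p. 43, §4.9 p. 55.
* [Tits1979] J. Tits, *Reductive groups over local fields*, Proc. Sympos. Pure Math. 33.1 (1979), §3.9.
-/

set_option autoImplicit false

noncomputable section

open Set Filter Topology NumberField IsDedekindDomain Polynomial ValuativeRel
open scoped Pointwise Matrix MatrixGroups ValuativeRel

namespace Literature.NumberTheory.Automorphic.UnitaryGroup

open Literature.NumberTheory.Automorphic.IntegralReduction

variable {F E : Type} [Field F] [NumberField F] [Field E] [NumberField E] [Algebra F E]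
  [Algebra.IsQuadraticExtension F E]
  (c : E ≃ₐ[F] E) (N : ℕ) (J : Matrix (Fin N) (Fin N) E) {v : HeightOneSpectrum (𝓞 F)} (hc : c ≠ 1)
  (w : PlacesOver E v) (hw : c • w.1 = w.1)

/-! ## §0 Characteristic polynomials through the one-place model -/

/-- **`charpoly γ_w = (charpoly γ).map (eval at w)`**: the characteristic polynomial of the `GL_N(E_w)`-avatar `γ_w = localNonsplitEquiv … γ` is the
`w`-component of that of `γ ∈ GL_N(E ⊗ F_v) = GL_N(∏_{w' ∣ v} E_{w'})`. [cite: Rogawski1990, §3.3 p. 21] -/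
theorem charpoly_coe_localNonsplitEquiv (γ : «local» E c N J v) :
    (((localNonsplitEquiv c J hc w hw γ : unitaryGroupOfForm (galAdicCompletionMap (L := E) c hw) (placeForm J w.1)) :
        GL (Fin N) (w.1.adicCompletion E)) : Matrix (Fin N) (Fin N) (w.1.adicCompletion E)).charpoly =
      (((γ : GL (Fin N) (LocalRing E v)) : Matrix (Fin N) (Fin N) (LocalRing E v))).charpoly.map
        (Pi.evalRingHom (fun w' : PlacesOver E v => w'.1.adicCompletion E) w) := by
  rw [← Matrix.charpoly_map]
  rfl

omit [Algebra.IsQuadraticExtension F E] in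
/-- Conjugate elements of `U(J)(F_v)` have the same characteristic polynomial in `GL_N(E ⊗ F_v)` (Mathlib `Matrix.charpoly_units_conj`).
[cite: Rogawski1990, §3.1 p. 19] -/
theorem charpoly_coe_eq_of_isConj {γ γ' : «local» E c N J v} (h : IsConj γ γ') :
    (((γ' : GL (Fin N) (LocalRing E v)) : Matrix (Fin N) (Fin N) (LocalRing E v))).charpoly =
      (((γ : GL (Fin N) (LocalRing E v)) : Matrix (Fin N) (Fin N) (LocalRing E v))).charpoly := by
  obtain ⟨g, rfl⟩ := isConj_iff.1 h
  have h1 := Matrix.charpoly_units_conj ((g : «local» E c N J v) : GL (Fin N) (LocalRing E v))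
    (Units.val ((γ : «local» E c N J v) : GL (Fin N) (LocalRing E v)))
  have hcoe : Units.val ((g * γ * g⁻¹ : «local» E c N J v) : GL (Fin N) (LocalRing E v)) =
      Units.val ((g : «local» E c N J v) : GL (Fin N) (LocalRing E v)) * Units.val ((γ : «local» E c N J v) : GL (Fin N) (LocalRing E v)) *
        Units.val (((g : «local» E c N J v) : GL (Fin N) (LocalRing E v))⁻¹) := rfl
  rw [hcoe, Matrix.coe_units_inv]
  exact h1

omit [NumberField F] [Algebra.IsQuadraticExtension F E] in
/-- **Bridge between the two residual-separability idioms**: for `g ∈ GL_N(𝒪_w)` (★ `glInt`, `ValuativeRel` integers) whose REDUCED matrix (★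
`IntegralReduction.redMat`, B-p14 (g29)'s idiom) has separable characteristic polynomial, the characteristic polynomial of `g` has an integral model over
Mathlib's `w.adicCompletionIntegers E` separable modulo `𝔪_w` (the `hsep` idiom of ★ `integralConj_unitaryGroupOfForm`) — along ★
`integer_valuation_eq_adicCompletionIntegers` (the two integer rings coincide) and ★ `GLn.charpoly_redMat_map_eq`. [cite: Kottwitz1986, Prop. 7.1] -/
theorem exists_integral_lift_separable_of_separable_redMat (g : GL (Fin N) (w.1.adicCompletion E)) (hg : g ∈ glInt N (w.1.adicCompletion E))
    (hsep : (redMat (g : Matrix (Fin N) (Fin N) (w.1.adicCompletion E))).charpoly.Separable) :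
    ∃ q : (w.1.adicCompletionIntegers E)[X],
      q.map (w.1.adicCompletionIntegers E).subtype = (g : Matrix (Fin N) (Fin N) (w.1.adicCompletion E)).charpoly ∧
        (q.map (IsLocalRing.residue (w.1.adicCompletionIntegers E))).Separable := by
  obtain ⟨gO, rfl⟩ := hg
  let e : 𝒪[w.1.adicCompletion E] ≃+* w.1.adicCompletionIntegers E :=
    RingEquiv.subringCongr (integer_valuation_eq_adicCompletionIntegers w.1)
  refine ⟨(gO : Matrix (Fin N) (Fin N) 𝒪[w.1.adicCompletion E]).charpoly.map (e : 𝒪[w.1.adicCompletion E] →+* w.1.adicCompletionIntegers E), ?_, ?_⟩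
  · rw [Polynomial.map_map]
    have hcomp : (w.1.adicCompletionIntegers E).subtype.comp (e : 𝒪[w.1.adicCompletion E] →+* w.1.adicCompletionIntegers E) = (𝒪[w.1.adicCompletion E]).subtype :=
      RingHom.ext fun _ => rfl
    rw [hcomp, ← Matrix.charpoly_map]
    rfl
  · rw [Polynomial.map_map, ← IsLocalRing.ResidueField.map_comp_residue (e : 𝒪[w.1.adicCompletion E] →+* w.1.adicCompletionIntegers E), ← Polynomial.map_map,
      ← GLn.charpoly_redMat_map_eq]
    exact hsep.map

/-! ## §1 (w1) One `K_v`-class: `hK1` at an unramified non-split place -/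

variable (hJh : (J.map c)ᵀ = J) (hv : Algebra.IsUnramifiedIn (𝓞 E) v.asIdeal) (hJw : IsUnit (placeForm J w.1))
  (hJi : hJw.unit ∈ glInt N (w.1.adicCompletion E))

include hJh hv hJi in
/-- **(w1) `(G·γ) ∩ K_v` IS ONE `K_v`-CLASS at an unramified non-split place of good reduction** — the binder `hK1` of ★
`classOrbitalIntegral_indicator_cmLocalIntegralLevel_eq_of_isCanonical`, for `γ ∈ K_v = U(J)(𝒪_v)` whose avatar `γ_w ∈ U(σ_w, J_w)(E_w) ∩ GL_N(𝒪_w)` has an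
integral model of its characteristic polynomial separable modulo `𝔪_w` (the `hsep` of ★ `integralConj_unitaryGroupOfForm`, verbatim): every `γ′ ∈ K_v`
conjugate to `γ` in `U(J)(F_v)` is conjugate to `γ` BY AN ELEMENT OF `K_v` (Kottwitz's Prop. 7.1 ★ `integralConj_unitaryGroupOfForm` along ★ `localNonsplitEquiv`,
★ `integralConj_of_mulEquiv`). [cite: Kottwitz1986, Prop. 7.1, Cor. 7.3] [cite: Rogawski1990, §3.3 p. 21] -/
theorem forall_exists_mem_localIntegralLevel_conj_eq_of_isConj_of_nonsplit (γ : «local» E c N J v)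
    (hγ : γ ∈ localIntegralLevel c N J v)
    (hsep : ∃ q : (w.1.adicCompletionIntegers E)[X],
      q.map (w.1.adicCompletionIntegers E).subtype =
          (((localNonsplitEquiv c J hc w hw γ : unitaryGroupOfForm (galAdicCompletionMap (L := E) c hw) (placeForm J w.1)) :
            GL (Fin N) (w.1.adicCompletion E)) : Matrix (Fin N) (Fin N) (w.1.adicCompletion E)).charpoly ∧
        (q.map (IsLocalRing.residue (w.1.adicCompletionIntegers E))).Separable) :
    ∀ γ' ∈ localIntegralLevel c N J v, IsConj γ γ' → ∃ k ∈ localIntegralLevel c N J v, k * γ * k⁻¹ = γ' := by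
  intro γ' hγ' hconj
  refine integralConj_of_mulEquiv (localNonsplitEquiv c J hc w hw).toMulEquiv (localIntegralLevel c N J v)
    ((glInt N (w.1.adicCompletion E)).subgroupOf (unitaryGroupOfForm (galAdicCompletionMap (L := E) c hw) (placeForm J w.1)))
    (fun u => by rw [Subgroup.mem_subgroupOf]; exact mem_localIntegralLevel_iff_of_smul_eq c N J hc w hw u) γ γ' ?_
  exact integralConj_unitaryGroupOfForm c N J hc hJh w hw hv hJw hJi _
    ((mem_localIntegralLevel_iff_of_smul_eq c N J hc w hw γ).1 hγ) hsep _
    ((mem_localIntegralLevel_iff_of_smul_eq c N J hc w hw γ').1 hγ')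
    (by
      change (((localNonsplitEquiv c J hc w hw γ' : unitaryGroupOfForm (galAdicCompletionMap (L := E) c hw) (placeForm J w.1)) :
          GL (Fin N) (w.1.adicCompletion E)) : Matrix (Fin N) (Fin N) (w.1.adicCompletion E)).charpoly =
        (((localNonsplitEquiv c J hc w hw γ : unitaryGroupOfForm (galAdicCompletionMap (L := E) c hw) (placeForm J w.1)) :
          GL (Fin N) (w.1.adicCompletion E)) : Matrix (Fin N) (Fin N) (w.1.adicCompletion E)).charpoly
      rw [charpoly_coe_localNonsplitEquiv, charpoly_coe_localNonsplitEquiv, charpoly_coe_eq_of_isConj c N J hconj])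

include hJh hv hJi in
/-- **(w1) in the reduced-matrix idiom** (B-p14's `redMat` predicate on the avatar, bridged by `exists_integral_lift_separable_of_separable_redMat`).
[cite: Kottwitz1986, Prop. 7.1, Cor. 7.3] [cite: Rogawski1990, §4.9 p. 55] -/
theorem forall_exists_mem_localIntegralLevel_conj_eq_of_isConj_of_separable_redMat (γ : «local» E c N J v)
    (hγ : γ ∈ localIntegralLevel c N J v)
    (hsep : (redMat (((localNonsplitEquiv c J hc w hw γ : unitaryGroupOfForm (galAdicCompletionMap (L := E) c hw) (placeForm J w.1)) :
        GL (Fin N) (w.1.adicCompletion E)) : Matrix (Fin N) (Fin N) (w.1.adicCompletion E))).charpoly.Separable) :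
    ∀ γ' ∈ localIntegralLevel c N J v, IsConj γ γ' → ∃ k ∈ localIntegralLevel c N J v, k * γ * k⁻¹ = γ' :=
  forall_exists_mem_localIntegralLevel_conj_eq_of_isConj_of_nonsplit c N J hc w hw hJh hv hJw hJi γ hγ
    (exists_integral_lift_separable_of_separable_redMat N w _ ((mem_localIntegralLevel_iff_of_smul_eq c N J hc w hw γ).1 hγ) hsep)

/-! ## §2 (w2) `Z(γ) ∩ K_v = compactCore Z(γ)`: `hcore` at a non-split place -/

omit hJh hv hJi

/-- **(w2) `Z(γ) ∩ K_v = compactCore Z(γ)`** — the binder `hcore` of ★ `classOrbitalIntegral_indicator_cmLocalIntegralLevel_eq_of_isCanonical`, at a non-split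
place `w ∣ v`, for `γ ∈ U(J)(F_v)` whose avatar `γ_w` lies in `GL_N(𝒪_w)` and is residually regular (`charpoly γ_w` separable, and separable after reduction
★ `redMat`): `⊆` because `Z(γ) ∩ K_v` is a compact subgroup of the closed `Z(γ)` (★ `preimage_val_subset_compactCore`); `⊇` because every compact subgroup
of `Z(γ)` maps, along the cod-restricted closed embedding `Z_{U(J)(F_v)}(γ) →* Z_{GL_N(E_w)}(γ_w)` (★ g0-U), to a compact subgroup of `Z_{GL}(γ_w)`, i.e. into
`compactCore Z_{GL}(γ_w) = Z_{GL}(γ_w) ∩ GL_N(𝒪_w)` (★ B-p14 `GLn.setOf_mem_glInt_eq_compactCore_centralizer`), and `γ_w ∈ GL_N(𝒪_w) ↔ γ ∈ K_v` (★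
`mem_localIntegralLevel_iff_of_smul_eq`). [cite: Kottwitz1986, Prop. 7.1] [cite: Tits1979, §3.9] [cite: Rogawski1990, §4.3 p. 43] -/
theorem setOf_mem_localIntegralLevel_eq_compactCore_centralizer_of_nonsplit (γ : «local» E c N J v)
    (hγ : γ ∈ localIntegralLevel c N J v)
    (hγs : ((((localNonsplitEquiv c J hc w hw γ : unitaryGroupOfForm (galAdicCompletionMap (L := E) c hw) (placeForm J w.1)) :
        GL (Fin N) (w.1.adicCompletion E)) : Matrix (Fin N) (Fin N) (w.1.adicCompletion E)).charpoly).Separable)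
    (hsep : (redMat (((localNonsplitEquiv c J hc w hw γ : unitaryGroupOfForm (galAdicCompletionMap (L := E) c hw) (placeForm J w.1)) :
        GL (Fin N) (w.1.adicCompletion E)) : Matrix (Fin N) (Fin N) (w.1.adicCompletion E))).charpoly.Separable) :
    {z : ↥(Subgroup.centralizer ({γ} : Set («local» E c N J v))) | (z : «local» E c N J v) ∈ localIntegralLevel c N J v} =
      compactCore ↥(Subgroup.centralizer ({γ} : Set («local» E c N J v))) := by
  refine Set.Subset.antisymm ?_ (fun z hz => ?_)
  · exact preimage_val_subset_compactCore (Subgroup.centralizer ({γ} : Set («local» E c N J v))) (localIntegralLevel c N J v)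
      (isClosed_coe_centralizer_singleton γ) (isCompact_localIntegralLevel c N J v)
  · obtain ⟨C, hC, hzC⟩ := (mem_compactCore_iff z).1 hz
    -- the closed embedding `U(J)(F_v) →* GL_N(E_w)` and its restriction to centralisers
    have hφ := isClosedEmbedding_subtype_comp_localNonsplitEquiv c N J hc w hw
    let ψ : ↥(Subgroup.centralizer ({γ} : Set («local» E c N J v))) →*
        ↥(Subgroup.centralizer ({((localNonsplitEquiv c J hc w hw γ :
            unitaryGroupOfForm (galAdicCompletionMap (L := E) c hw) (placeForm J w.1)) : GL (Fin N) (w.1.adicCompletion E))} :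
          Set (GL (Fin N) (w.1.adicCompletion E)))) :=
      ((((unitaryGroupOfForm (galAdicCompletionMap (L := E) c hw) (placeForm J w.1)).subtype.comp
          (localNonsplitEquiv c J hc w hw).toMonoidHom)).comp (Subgroup.centralizer ({γ} : Set («local» E c N J v))).subtype).codRestrict _
        fun u => apply_mem_centralizer_of_mem_centralizer
          ((unitaryGroupOfForm (galAdicCompletionMap (L := E) c hw) (placeForm J w.1)).subtype.comp
            (localNonsplitEquiv c J hc w hw).toMonoidHom) γ u.2
    have hψc : Continuous ψ := (hφ.continuous.comp continuous_subtype_val).subtype_mk _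
    have hmem : ψ z ∈ compactCore ↥(Subgroup.centralizer ({((localNonsplitEquiv c J hc w hw γ :
            unitaryGroupOfForm (galAdicCompletionMap (L := E) c hw) (placeForm J w.1)) : GL (Fin N) (w.1.adicCompletion E))} :
          Set (GL (Fin N) (w.1.adicCompletion E)))) :=
      (mem_compactCore_iff _).2 ⟨C.map ψ, by rw [Subgroup.coe_map]; exact hC.image hψc, ⟨z, hzC, rfl⟩⟩
    have hγint : ((localNonsplitEquiv c J hc w hw γ : unitaryGroupOfForm (galAdicCompletionMap (L := E) c hw) (placeForm J w.1)) :
        GL (Fin N) (w.1.adicCompletion E)) ∈ glInt N (w.1.adicCompletion E) :=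
      (mem_localIntegralLevel_iff_of_smul_eq c N J hc w hw γ).1 hγ
    rw [← GLn.setOf_mem_glInt_eq_compactCore_centralizer hγint hγs hsep] at hmem
    exact (mem_localIntegralLevel_iff_of_smul_eq c N J hc w hw (z : «local» E c N J v)).2 hmem

end Literature.NumberTheory.Automorphic.UnitaryGroup

end
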